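import Summits.QuantumFields.QCD.Theorems.ExtinctionBuildsQCD.Negative.InertiaPencil

/-!
# Negative knowledge for crux `ExtinctionBuildsQCD` (stmt-QuantumFields-8968), §5b: the crossing
# budget — a step function with controlled local jumps, and the Hermitian pencil

Certified copy of §5 (matrix part, second half) of the cdisprove work file
`Summits/QuantumFields/QCD/Cruxes/ExtinctionBuildsQCD/Disproof.lean` (refuter, cdisprove seat,
cycle 2). Supports stmt-QuantumFields-8968; asserts no route item.

* `abs_sub_le_countP_of_local_jumps`: an `ℕ`-valued function `f` of a real variable which near every
  `s` cannot drop and can rise by at most `z s`, with `z s ≤ #_R(s)` for a finite multiset `R` of reals,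
  satisfies `|f b - f a| ≤ #(R ∩ [a, b])` for `a ≤ b`. Proof: `f` is locally constant off `R`, hence
  constant on `R`-free closed intervals (connectedness of `Icc`, `IsLocallyConstant`); induction on
  the number of points of `R` strictly inside, crossing the least one; endpoints shrunk off `R` and
  paid once (`count_add_count_add_countP_le`).
* `abs_negRootCount_sub_le_countP_real`: for Hermitian `A`, `Γ` with `Γ² = 1` and `|Re⟨v,Γv⟩| ≤ ‖v‖²`,
  `|n₋(A + bΓ) - n₋(A + aΓ)| ≤ #{real eigenvalues of ΓA in [-b, -a]}` (with algebraic multiplicity),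
  from `negRootCount_local` and `zeroRootCount_le_count` of `InertiaPencil.lean`.

References: Edwards–Heller–Narayanan, Nucl. Phys. B 535 (1998) 403, §2 (level crossings of
`H_W(m)` ↔ real eigenvalues of `D_W`); Kato, *Perturbation Theory for Linear Operators* (1966),
II §6.5 (spectral flow of Hermitian families; here replaced by Sylvester inertia).
-/

noncomputable section

namespace Summit.QuantumFields.QCD.Theorems.ExtinctionBuildsQCD.Negative

open scoped BigOperators Topology Classical MeasureTheory Matrix ComplexConjugate
open Filter MeasureTheory Matrix
open Literature.MathematicalPhysics.QuantumLattice Literature.MathematicalPhysics.QuantumFieldTheory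
  Literature.Probability.LatticeModels
open Summit.QuantumFields.QCD.Theses.SpectralDefectExtinction

section CrossingBudget

variable {n : Type*} [Fintype n] [DecidableEq n]

/-! ### The abstract crossing budget: a step function with controlled local jumps -/

omit [Fintype n] [DecidableEq n] in
/-- Counting with three mutually exclusive sub-predicates of `[a, b]`. -/
theorem count_add_count_add_countP_le (R : Multiset ℝ) {a b : ℝ} (hab : a < b) :
    R.count a + R.count b + R.countP (fun s => a < s ∧ s < b) ≤
      R.countP (fun s => a ≤ s ∧ s ≤ b) := by
  induction R using Multiset.induction_on with
  | empty => simp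
  | cons x R ih =>
    rw [Multiset.count_cons, Multiset.count_cons, Multiset.countP_cons, Multiset.countP_cons]
    have key : (if a = x then 1 else 0) + (if b = x then 1 else 0) +
        (if a < x ∧ x < b then 1 else 0) ≤ (if a ≤ x ∧ x ≤ b then (1 : ℕ) else 0) := by
      by_cases hax : a = x
      · subst hax
        rw [if_pos rfl, if_neg hab.ne', if_neg (fun h => lt_irrefl _ h.1), if_pos ⟨le_rfl, hab.le⟩]
      · by_cases hbx : b = x
        · subst hbx
          rw [if_neg hax, if_pos rfl, if_neg (fun h => lt_irrefl _ h.2), if_pos ⟨hab.le, le_rfl⟩]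
        · rw [if_neg hax, if_neg hbx]
          by_cases hm : a < x ∧ x < b
          · rw [if_pos hm, if_pos ⟨hm.1.le, hm.2.le⟩]
          · rw [if_neg hm]; exact Nat.zero_le _
    omega

omit [Fintype n] [DecidableEq n] in
/-- Monotonicity of `countP` in the predicate. -/
theorem countP_mono_pred (R : Multiset ℝ) {p q : ℝ → Prop} [DecidablePred p] [DecidablePred q]
    (h : ∀ x, p x → q x) : R.countP p ≤ R.countP q := by
  rw [Multiset.countP_eq_card_filter, Multiset.countP_eq_card_filter]
  exact Multiset.card_le_card (Multiset.monotone_filter_right R h)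

omit [Fintype n] [DecidableEq n] in
/-- Splitting a count at a distinguished point. -/
theorem countP_eq_count_add_countP (R : Multiset ℝ) {p q : ℝ → Prop} [DecidablePred p]
    [DecidablePred q] (s₀ : ℝ) (hiff : ∀ x ∈ R, p x ↔ (x = s₀ ∨ q x)) (hdisj : ∀ x, q x → x ≠ s₀) :
    R.countP p = R.count s₀ + R.countP q := by
  classical
  rw [Multiset.countP_eq_card_filter, Multiset.countP_eq_card_filter, Multiset.count_eq_card_filter_eq,
    ← Multiset.card_add, Multiset.filter_congr hiff, Multiset.filter_add_filter]
  have h0 : Multiset.filter (fun x => s₀ = x ∧ q x) R = 0 :=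
    Multiset.filter_eq_nil.2 fun x _ h => hdisj x h.2 h.1.symm
  rw [h0, add_zero]
  congr 1
  exact Multiset.filter_congr fun x _ => by rw [eq_comm]

omit [Fintype n] [DecidableEq n] in
/-- **Abstract crossing budget.** Let `f : ℝ → ℕ` be a function which near every point `s` cannot
drop and can rise by at most `z s` (`f s ≤ f t ≤ f s + z s` for `|t - s| < r(s)`), where the jump
allowance `z` is dominated by the multiplicity function of a finite multiset `R` of reals. Then the
variation of `f` over `[a, b]` is at most the number of points of `R` in `[a, b]`, with multiplicity:
`|f b - f a| ≤ #(R ∩ [a, b])`. (Topology: `f` is locally constant off `R`, so constant on root-free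
intervals by connectedness; the roots are crossed one at a time.) -/
theorem abs_sub_le_countP_of_local_jumps (f z : ℝ → ℕ) (R : Multiset ℝ)
    (hloc : ∀ s : ℝ, ∃ r : ℝ, 0 < r ∧ ∀ t : ℝ, |t - s| < r → f s ≤ f t ∧ f t ≤ f s + z s)
    (hzR : ∀ s, z s ≤ R.count s) {a b : ℝ} (hab : a ≤ b) :
    |(f b : ℤ) - f a| ≤ R.countP (fun s => a ≤ s ∧ s ≤ b) := by
  classical
  -- (E) constancy on jump-free closed intervals
  have hE : ∀ u v : ℝ, u ≤ v → (∀ s, u ≤ s → s ≤ v → z s = 0) → f u = f v := by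
    intro u v huv hz
    have hlc : IsLocallyConstant (fun x : Set.Icc u v => f x.1) := by
      rw [IsLocallyConstant.iff_eventually_eq]
      intro x
      obtain ⟨r, hr, hloc'⟩ := hloc x.1
      have hz0 : z x.1 = 0 := hz x.1 x.2.1 x.2.2
      have hball : ∀ t, |t - x.1| < r → f t = f x.1 := fun t ht => by
        have := hloc' t ht; omega
      have hmem : {y : Set.Icc u v | |(y : ℝ) - x.1| < r} ∈ 𝓝 x := by
        have hopen : IsOpen {y : Set.Icc u v | |(y : ℝ) - x.1| < r} := by
          have : {y : Set.Icc u v | |(y : ℝ) - x.1| < r} =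
              (fun y : Set.Icc u v => (y : ℝ)) ⁻¹' Metric.ball x.1 r := by
            ext y; simp [Metric.mem_ball, Subtype.dist_eq, Real.dist_eq]
          rw [this]
          exact continuous_subtype_val.isOpen_preimage _ Metric.isOpen_ball
        exact hopen.mem_nhds (by simp [hr])
      filter_upwards [hmem] with y hy
      exact hball y hy
    haveI : PreconnectedSpace (Set.Icc u v) := Subtype.preconnectedSpace isPreconnected_Icc
    exact hlc.apply_eq_of_preconnectedSpace ⟨u, le_rfl, huv⟩ ⟨v, huv, le_rfl⟩
  -- `z` vanishes off `R`
  have hz_off : ∀ s, s ∉ R → z s = 0 := fun s hs => by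
    have := hzR s; rw [Multiset.count_eq_zero_of_notMem hs] at this; omega
  -- (STEP) endpoints off `R`: induction on the number of distinct points of `R` strictly inside
  have hstep : ∀ N : ℕ, ∀ a' b' : ℝ, a' ≤ b' → a' ∉ R → b' ∉ R →
      (R.toFinset.filter fun s => a' < s ∧ s < b').card = N →
        |(f b' : ℤ) - f a'| ≤ R.countP (fun s => a' < s ∧ s < b') := by
    intro N
    induction N with
    | zero =>
      intro a' b' hab' ha' hb' hcard
      have hfree : ∀ s, a' ≤ s → s ≤ b' → z s = 0 := by
        intro s h1 h2
        by_cases hs : s ∈ R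
        · exfalso
          have hsa : s ≠ a' := fun h => ha' (h ▸ hs)
          have hsb : s ≠ b' := fun h => hb' (h ▸ hs)
          have hmem : s ∈ R.toFinset.filter fun s => a' < s ∧ s < b' :=
            Finset.mem_filter.2 ⟨Multiset.mem_toFinset.2 hs, lt_of_le_of_ne h1 hsa.symm,
              lt_of_le_of_ne h2 hsb⟩
          rw [Finset.card_eq_zero] at hcard
          rw [hcard] at hmem
          exact absurd hmem (Finset.notMem_empty _)
        · exact hz_off s hs
      rw [hE a' b' hab' hfree, sub_self, abs_zero]
      positivity
    | succ N ih =>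
      intro a' b' hab' ha' hb' hcard
      set S := R.toFinset.filter fun s => a' < s ∧ s < b' with hS_def
      have hSne : S.Nonempty := by rw [← Finset.card_pos, hcard]; exact Nat.succ_pos _
      set s₀ := S.min' hSne with hs₀_def
      have hs₀S : s₀ ∈ S := Finset.min'_mem _ _
      have hs₀R : s₀ ∈ R := Multiset.mem_toFinset.1 (Finset.mem_filter.1 hs₀S).1
      have hs₀a : a' < s₀ := (Finset.mem_filter.1 hs₀S).2.1
      have hs₀b : s₀ < b' := (Finset.mem_filter.1 hs₀S).2.2
      have hSmin : ∀ x ∈ S, s₀ ≤ x := fun x hx => Finset.min'_le _ _ hx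
      obtain ⟨r, hr, hlocr⟩ := hloc s₀
      -- the next point to the right of `s₀` (capped by `b'` and by `s₀ + r`)
      set T := insert b' (R.toFinset.filter fun x => s₀ < x) with hT_def
      have hTne : T.Nonempty := Finset.insert_nonempty _ _
      set c := min (s₀ + r) (T.min' hTne) with hc_def
      have hTgt : ∀ x ∈ T, s₀ < x := by
        intro x hx
        rcases Finset.mem_insert.1 hx with rfl | hx
        · exact hs₀b
        · exact (Finset.mem_filter.1 hx).2
      have hc₀ : s₀ < c := lt_min (by linarith) ((Finset.lt_min'_iff _ _).2 hTgt)
      have hcb : c ≤ b' := (min_le_right _ _).trans (Finset.min'_le _ _ (Finset.mem_insert_self _ _))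
      have hcr : c ≤ s₀ + r := min_le_left _ _
      have hcR : ∀ x ∈ R, s₀ < x → c ≤ x := fun x hx hxs =>
        (min_le_right _ _).trans (Finset.min'_le _ _ (Finset.mem_insert_of_mem
          (Finset.mem_filter.2 ⟨Multiset.mem_toFinset.2 hx, hxs⟩)))
      set a'' := (s₀ + c) / 2 with ha''_def
      have h1 : s₀ < a'' := by rw [ha''_def]; linarith
      have h2 : a'' < c := by rw [ha''_def]; linarith
      have ha''R : a'' ∉ R := fun h => absurd (hcR _ h h1) (not_le.2 h2)
      have ha''b : a'' ≤ b' := (h2.trans_le hcb).le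
      -- the points strictly inside `(a'', b')` are those of `S` other than `s₀`
      have hfilt : (R.toFinset.filter fun s => a'' < s ∧ s < b') = S.erase s₀ := by
        ext x
        simp only [Finset.mem_filter, Finset.mem_erase, hS_def, Multiset.mem_toFinset]
        constructor
        · rintro ⟨hxR, hxa, hxb⟩
          exact ⟨(h1.trans hxa).ne', hxR, hs₀a.trans (h1.trans hxa), hxb⟩
        · rintro ⟨hxne, hxR, hxa, hxb⟩
          have hxS : x ∈ S := Finset.mem_filter.2 ⟨Multiset.mem_toFinset.2 hxR, hxa, hxb⟩
          have hlt : s₀ < x := lt_of_le_of_ne (hSmin x hxS) (Ne.symm hxne)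
          exact ⟨hxR, h2.trans_le (hcR x hxR hlt), hxb⟩
      have hcard' : (R.toFinset.filter fun s => a'' < s ∧ s < b').card = N := by
        rw [hfilt, Finset.card_erase_of_mem hs₀S, hcard]; rfl
      have hIH := ih a'' b' ha''b ha''R hb' hcard'
      -- the jump across `s₀`
      set t := max a' (s₀ - r / 2) with ht_def
      have hta : a' ≤ t := le_max_left _ _
      have hts : t < s₀ := max_lt hs₀a (by linarith)
      have htr : |t - s₀| < r := by
        rw [abs_sub_lt_iff]; constructor <;> [linarith; linarith [le_max_right a' (s₀ - r / 2)]]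
      have ha''r : |a'' - s₀| < r := by
        rw [abs_sub_lt_iff]; constructor <;> linarith
      have hft : f a' = f t := by
        refine hE a' t hta fun s hs1 hs2 => ?_
        by_cases hsR : s ∈ R
        · exfalso
          have hsa : s ≠ a' := fun h => ha' (h ▸ hsR)
          have hsS : s ∈ S := Finset.mem_filter.2
            ⟨Multiset.mem_toFinset.2 hsR, lt_of_le_of_ne hs1 hsa.symm, (hs2.trans_lt hts).trans hs₀b⟩
          exact absurd (hSmin s hsS) (not_le.2 (hs2.trans_lt hts))
        · exact hz_off s hsR
      have hj1 := hlocr t htr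
      have hj2 := hlocr a'' ha''r
      have hzs₀ := hzR s₀
      have hjump : |(f a'' : ℤ) - f a'| ≤ R.count s₀ := by
        rw [hft, abs_le]; constructor <;> omega
      -- count bookkeeping: points of `R` in `(a', b')` are `s₀` or in `(a'', b')`
      have hsplit : R.countP (fun s => a' < s ∧ s < b') =
          R.count s₀ + R.countP (fun s => a'' < s ∧ s < b') := by
        refine countP_eq_count_add_countP R s₀ (fun x hx => ⟨fun h => ?_, fun h => ?_⟩)
          (fun x hx hxs => absurd hxs (h1.trans hx.1).ne')
        · by_cases hxs : x = s₀
          · exact Or.inl hxs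
          · have hxS : x ∈ S := Finset.mem_filter.2 ⟨Multiset.mem_toFinset.2 hx, h⟩
            have hlt : s₀ < x := lt_of_le_of_ne (hSmin x hxS) (Ne.symm hxs)
            exact Or.inr ⟨h2.trans_le (hcR x hx hlt), h.2⟩
        · rcases h with rfl | h
          · exact ⟨hs₀a, hs₀b⟩
          · exact ⟨hs₀a.trans (h1.trans h.1), h.2⟩
      calc |(f b' : ℤ) - f a'| = |((f b' : ℤ) - f a'') + ((f a'' : ℤ) - f a')| := by ring_nf
        _ ≤ |(f b' : ℤ) - f a''| + |(f a'' : ℤ) - f a'| := abs_add_le _ _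
        _ ≤ R.countP (fun s => a'' < s ∧ s < b') + R.count s₀ := add_le_add hIH hjump
        _ = R.countP (fun s => a' < s ∧ s < b') := by rw [hsplit]; push_cast; ring
  -- (FINAL) general endpoints: shrink into `(a, b)` off `R`, pay the endpoint jumps once
  rcases hab.eq_or_lt with rfl | hab'
  · rw [sub_self, abs_zero]; positivity
  obtain ⟨ra, hra, hloca⟩ := hloc a
  obtain ⟨rb, hrb, hlocb⟩ := hloc b
  -- `a'`
  set Ta := insert b (R.toFinset.filter fun x => a < x) with hTa_def
  have hTane : Ta.Nonempty := Finset.insert_nonempty _ _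
  set ca := min (a + ra) (Ta.min' hTane) with hca_def
  have hTagt : ∀ x ∈ Ta, a < x := by
    intro x hx
    rcases Finset.mem_insert.1 hx with rfl | hx
    · exact hab'
    · exact (Finset.mem_filter.1 hx).2
  have hca₀ : a < ca := lt_min (by linarith) ((Finset.lt_min'_iff _ _).2 hTagt)
  have hcab : ca ≤ b := (min_le_right _ _).trans (Finset.min'_le _ _ (Finset.mem_insert_self _ _))
  have hcar : ca ≤ a + ra := min_le_left _ _
  have hcaR : ∀ x ∈ R, a < x → ca ≤ x := fun x hx hxs =>
    (min_le_right _ _).trans (Finset.min'_le _ _ (Finset.mem_insert_of_mem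
      (Finset.mem_filter.2 ⟨Multiset.mem_toFinset.2 hx, hxs⟩)))
  set a' := (a + ca) / 2 with ha'_def
  have ha1 : a < a' := by rw [ha'_def]; linarith
  have ha2 : a' < ca := by rw [ha'_def]; linarith
  have ha'R : a' ∉ R := fun h => absurd (hcaR _ h ha1) (not_le.2 ha2)
  have ha'b : a' < b := ha2.trans_le hcab
  -- `b'`
  set Tb := insert a' (R.toFinset.filter fun x => x < b) with hTb_def
  have hTbne : Tb.Nonempty := Finset.insert_nonempty _ _
  set cb := max (b - rb) (Tb.max' hTbne) with hcb_def
  have hTblt : ∀ x ∈ Tb, x < b := by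
    intro x hx
    rcases Finset.mem_insert.1 hx with rfl | hx
    · exact ha'b
    · exact (Finset.mem_filter.1 hx).2
  have hcb₀ : cb < b := max_lt (by linarith) ((Finset.max'_lt_iff _ _).2 hTblt)
  have hcba : a' ≤ cb := (Finset.le_max' _ _ (Finset.mem_insert_self _ _)).trans (le_max_right _ _)
  have hcbr : b - rb ≤ cb := le_max_left _ _
  have hcbR : ∀ x ∈ R, x < b → x ≤ cb := fun x hx hxs =>
    (Finset.le_max' _ _ (Finset.mem_insert_of_mem
      (Finset.mem_filter.2 ⟨Multiset.mem_toFinset.2 hx, hxs⟩))).trans (le_max_right _ _)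
  set b' := (cb + b) / 2 with hb'_def
  have hb1 : cb < b' := by rw [hb'_def]; linarith
  have hb2 : b' < b := by rw [hb'_def]; linarith
  have hb'R : b' ∉ R := fun h => absurd (hcbR _ h hb2) (not_le.2 hb1)
  have ha'b' : a' ≤ b' := (hcba.trans_lt hb1).le
  -- the interior estimate
  have hint := hstep _ a' b' ha'b' ha'R hb'R rfl
  have hint' : |(f b' : ℤ) - f a'| ≤ R.countP (fun s => a < s ∧ s < b) :=
    hint.trans (by
      exact_mod_cast countP_mono_pred R (p := fun s => a' < s ∧ s < b') (q := fun s => a < s ∧ s < b)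
        fun x hx => ⟨ha1.trans hx.1, hx.2.trans hb2⟩)
  -- the endpoint jumps
  have hja := hloca a' (by rw [abs_sub_lt_iff]; constructor <;> linarith)
  have hjb := hlocb b' (by rw [abs_sub_lt_iff]; constructor <;> linarith)
  have hza := hzR a
  have hzb := hzR b
  have hfin := count_add_count_add_countP_le R hab'
  rw [abs_le] at hint' ⊢
  constructor <;> omega

/-- **Crossing budget for a Hermitian pencil `A + tΓ` with `Γ² = 1`.** The negative counts at two
parameters `a ≤ b` differ by at most the number of REAL eigenvalues (with algebraic multiplicity) of
`Γ A` in `[-b, -a]`: every change of `n₋(A + tΓ)` happens at a `t` with `ΓA + t` singular and is at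
most the nullity there. -/
theorem abs_negRootCount_sub_le_countP_real {A Γ : Matrix n n ℂ} (hA : A.IsHermitian)
    (hΓ : Γ.IsHermitian) (hΓ2 : Γ * Γ = 1)
    (hΓv : ∀ v : n → ℂ, |(star v ⬝ᵥ (Γ *ᵥ v)).re| ≤ ∑ i, ‖v i‖ ^ 2) {a b : ℝ} (hab : a ≤ b) :
    |(negRootCount (A + ((b : ℝ) : ℂ) • Γ) : ℤ) - negRootCount (A + ((a : ℝ) : ℂ) • Γ)| ≤
      (Γ * A).charpoly.roots.countP (fun z => z.im = 0 ∧ -b ≤ z.re ∧ z.re ≤ -a) := by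
  classical
  set R : Multiset ℝ := (((Γ * A).charpoly.roots.filter fun z : ℂ => z.im = 0).map fun z : ℂ => -z.re)
    with hR
  have h := abs_sub_le_countP_of_local_jumps (fun t => negRootCount (A + ((t : ℝ) : ℂ) • Γ))
    (fun t => zeroRootCount (A + ((t : ℝ) : ℂ) • Γ)) R (negRootCount_local hA hΓ hΓv) (fun s => ?_) hab
  · refine h.trans (le_of_eq ?_)
    congr 1
    rw [hR, Multiset.countP_map, Multiset.filter_filter, ← Multiset.countP_eq_card_filter]
    exact Multiset.countP_congr rfl fun z _ => propext
      ⟨fun h => ⟨h.2, by linarith [h.1.2], by linarith [h.1.1]⟩,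
        fun h => ⟨⟨by linarith [h.2.2], by linarith [h.2.1]⟩, h.1⟩⟩
  · -- `n₀(A + sΓ) ≤ mult_{-s} ≤ #(R ∋ s)`
    refine (zeroRootCount_le_count hA hΓ hΓ2 s).trans ?_
    rw [hR, Multiset.count_map, Multiset.filter_filter, Multiset.count_eq_card_filter_eq]
    refine Multiset.card_le_card (Multiset.monotone_filter_right _ fun z hz => ?_)
    subst hz
    exact ⟨by simp, by simp⟩

end CrossingBudget

end Summit.QuantumFields.QCD.Theorems.ExtinctionBuildsQCD.Negative

end
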